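import Mathlib
import Summits.FinalStateConjecture.FinalStateConjecture.Theorems.PhotonSphereChannelsUniformPhotonSphereChannelsRQFormRecursion
import Summits.FinalStateConjecture.FinalStateConjecture.Theorems.PhotonSphereChannelsUniformPhotonSphereChannelsRChainBookkeeping
import Summits.FinalStateConjecture.FinalStateConjecture.Theorems.PhotonSphereChannelsUniformPhotonSphereChannelsRRungZeroMajorant
import Summits.FinalStateConjecture.FinalStateConjecture.Theorems.PhotonSphereChannelsUniformPhotonSphereChannelsRCoeffInversion

/-!
# Crux `UniformPhotonSphereChannelsR` (K1R, stmt-FinalStateConjecture-14074), line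
# `crum-peeling-recessive-tower` — Theorem A assembly: `stub_coeffMajorant` from the rung step

Skeleton v5 of the line (lead c2) splits the last open stub `stub_coeffMajorant` (the uniform
majorant for the Taylor coefficients `G k n`, `Ω k n` of the recessive Riccati–Crum chain of the
Regge–Wheeler potential) into five registered sub-stubs: `stub_qFormRecursion`,
`stub_convolutionBounds`, `stub_chainBookkeeping`, `stub_rungZeroMajorant` (all four landed under
`Theorems/PhotonSphereChannelsUniformPhotonSphereChannelsR*.lean`) and the one-rung majorant step
`stub_rungStepMajorant` (open at the time of writing).  This file proves, in the tree, the
composition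

  `coeffMajorant_of_rungStep :
      (statement of stub_convolutionBounds) → (statement of stub_rungStepMajorant) →
        (statement of stub_coeffMajorant)`,

so that the moment the rung step lands, `stub_coeffMajorant` is one application away
(`coeffMajorant_of_rungStep stub_convolutionBounds stub_rungStepMajorant`), independently of any
seat's private skeleton.  (The convolution constants are taken as the hypothesis `hCV`, verbatim the
registered `stub_convolutionBounds`, so that this file does not depend on that module.)

The argument is the bookkeeping of the lead's `TheoremA` §1 (crux `NOTES.md`): along the ladder
`k = 0, 1, …, ℓ - 1` (residual angular momentum `λ_k = ℓ - k`) carry the radius and the angle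
  `B_k := 16 + Σ_{j<k} Δ_{ℓ-j}`,  `Δ_λ := (2λ-1)/(λ(λ-1))`,
  `θ_k := 2⁻¹⁰ ∏_{j<k} (1 - 2/(2(ℓ-j)-1)²)`,
and the invariant `16 ≤ B_k`, `|G k 1| ≤ B_k`, `0 < θ_k ≤ 2⁻¹⁰`, `|G k n| ≤ 2 (B_k/θ_k)^{n-1}/n²` (`n ≥ 2`)
(`coeffMajorantAssembly_induction`): the base is `stub_rungZeroMajorant` (`G 0 1 ∈ [0, 7/6]`,
`|G 0 n| ≤ 2·16384^{n-1}/n²`, and `B_0/θ_0 = 16·1024 = 16384`), the step is the rung step fed with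
the exact `q`-form identities of `stub_qFormRecursion` (`coeffMajorantAssembly_shift`,
`coeffMajorantAssembly_rung`; the convolution constants it consumes are the hypothesis `hCV`).
The export (`coeffMajorant_of_rungStep`) uses `stub_chainBookkeeping` (`∏ ≥ 4/9`, `Σ Δ ≤ 1 + 2 log ℓ`),
whence `2 B_k/θ_k ≤ 4608 (17 + 2 log ℓ) ≤ 80000 (1 + log (ℓ+1))`, and the inversion majorant
`coeffMajorant_inversion` (`|Ω k n| ≤ (2 B_k/θ_k)ⁿ`).  The constant is `K = 80000`. -/

-- `Summit.<S>.<S>` repeats a namespace component by design (D-0017); off here as in the lakefile.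
set_option linter.dupNamespace false

noncomputable section

open Finset

namespace Summit.FinalStateConjecture.FinalStateConjecture.Theorems.CrumPeelingRecessiveTower

/-- **Induction along the ladder** (abstract schedules).  With `B k = 16 + Σ_{j<k} Δ j`,
`θ k = 2⁻¹⁰ ∏_{j<k} τ j`, `Δ j ≥ 0`, `0 < τ j ≤ 1` (`j + 2 ≤ ℓ`), the rung-`0` bounds
`|G 0 1| ≤ 2`, `|G 0 n| ≤ 2·16384^{n-1}/n²`, the shift law `G (k+1) 1 = G k 1 - Δ k` and a one-rung
step for the profile bound, every rung `k ≤ ℓ - 1` satisfies `16 ≤ B k`, `|G k 1| ≤ B k`, `0 < θ k ≤ 2⁻¹⁰`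
and `|G k n| ≤ 2 (B k/θ k)^{n-1}/n²` (`n ≥ 2`). -/
theorem coeffMajorantAssembly_induction (ℓ : ℕ) (G : ℕ → ℕ → ℝ) (Δ τ B θ : ℕ → ℝ)
    (hB : ∀ k, B k = 16 + ∑ j ∈ Finset.range k, Δ j)
    (hθ : ∀ k, θ k = (1 / 1024) * ∏ j ∈ Finset.range k, τ j)
    (hΔ : ∀ k, k + 2 ≤ ℓ → 0 ≤ Δ k)
    (hτ : ∀ k, k + 2 ≤ ℓ → 0 < τ k ∧ τ k ≤ 1)
    (h01 : |G 0 1| ≤ 2)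
    (h0n : ∀ n, 2 ≤ n → |G 0 n| ≤ 2 * (16384 : ℝ) ^ (n - 1) / (n : ℝ) ^ 2)
    (hstep1 : ∀ k, k + 2 ≤ ℓ → G (k + 1) 1 = G k 1 - Δ k)
    (hstepn : ∀ k, k + 2 ≤ ℓ → 0 < θ k → θ k ≤ 1 / 1024 → 16 ≤ B k → |G k 1| ≤ B k →
        (∀ n, 2 ≤ n → |G k n| ≤ 2 * (B k / θ k) ^ (n - 1) / (n : ℝ) ^ 2) →
        ∀ n, 2 ≤ n → |G (k + 1) n| ≤ 2 * ((B k + Δ k) / (θ k * τ k)) ^ (n - 1) / (n : ℝ) ^ 2) :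
    ∀ k, k + 1 ≤ ℓ →
      16 ≤ B k ∧ |G k 1| ≤ B k ∧ 0 < θ k ∧ θ k ≤ 1 / 1024 ∧
        ∀ n, 2 ≤ n → |G k n| ≤ 2 * (B k / θ k) ^ (n - 1) / (n : ℝ) ^ 2 := by
  intro k
  induction k with
  | zero =>
    intro _
    have hB0 : B 0 = 16 := by simp [hB]
    have hθ0 : θ 0 = 1 / 1024 := by simp [hθ]
    refine ⟨by rw [hB0], by rw [hB0]; linarith, by rw [hθ0]; norm_num, by rw [hθ0], ?_⟩
    intro n hn
    have hq : B 0 / θ 0 = 16384 := by rw [hB0, hθ0]; norm_num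
    exact hq ▸ h0n n hn
  | succ k ih =>
    intro hk
    have hk2 : k + 2 ≤ ℓ := by omega
    obtain ⟨hBk, hG1, ihθ, ihθ', ihn⟩ := ih (by omega)
    have hBs : B (k + 1) = B k + Δ k := by rw [hB, hB, Finset.sum_range_succ]; ring
    have hθs : θ (k + 1) = θ k * τ k := by rw [hθ, hθ, Finset.prod_range_succ]; ring
    obtain ⟨hτ0, hτ1⟩ := hτ k hk2
    have hΔk := hΔ k hk2
    refine ⟨?_, ?_, ?_, ?_, ?_⟩
    · rw [hBs]; linarith
    · rw [hstep1 k hk2, hBs]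
      have habs : |G k 1 - Δ k| ≤ |G k 1| + Δ k := by
        rw [abs_le]
        constructor
        · linarith [neg_abs_le (G k 1)]
        · linarith [le_abs_self (G k 1)]
      linarith
    · rw [hθs]; exact mul_pos ihθ hτ0
    · rw [hθs]; nlinarith
    · intro n hn
      rw [hBs, hθs]
      exact hstepn k hk2 ihθ ihθ' hBk hG1 ihn n hn

/-- **Exact shift law of one rung** (mode `n = 1`), read off `stub_qFormRecursion`:
`G (k+1) 1 = G k 1 - Δ_λ`, `Δ_λ = (2λ-1)/(λ(λ-1))`, `λ = ℓ - k ≥ 2`. -/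
theorem coeffMajorantAssembly_shift (ℓ k : ℕ) (hk : k + 2 ≤ ℓ) (Ω G : ℕ → ℕ → ℝ)
    (hΩ0 : ∀ k, Ω k 0 = 1) (hG0 : ∀ k, G k 0 = 1)
    (hinv : ∀ k n, ∑ i ∈ Finset.range (n + 1), G k i * Ω k (n - i) = if n = 0 then 1 else 0)
    (hrung : ∀ n, ((ℓ : ℝ) - k - 1) ^ 2 * ∑ i ∈ Finset.range (n + 1), Ω (k + 1) i * Ω (k + 1) (n - i)
          + ((ℓ : ℝ) - k - 1) * (((n : ℝ) + 1) * Ω (k + 1) n - 2 * (n : ℝ) * Ω (k + 1) (n - 1))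
          = ((ℓ : ℝ) - k) ^ 2 * ∑ i ∈ Finset.range (n + 1), Ω k i * Ω k (n - i)
          - ((ℓ : ℝ) - k) * (((n : ℝ) + 1) * Ω k n - 2 * (n : ℝ) * Ω k (n - 1))) :
    G (k + 1) 1 = G k 1 - (2 * ((ℓ : ℝ) - k) - 1) / (((ℓ : ℝ) - k) * (((ℓ : ℝ) - k) - 1)) := by
  have hαn : ∀ n : ℕ, 2 ≤ n →
      (fun m : ℕ => if m = 0 then (0 : ℝ) else if m = 1 then -2
        else (1 - (m : ℝ)) * G k m + 2 * ((m : ℝ) - 2) * G k (m - 1)) n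
        = (1 - (n : ℝ)) * G k n + 2 * ((n : ℝ) - 2) * G k (n - 1) := by
    intro n hn
    have h0 : n ≠ 0 := by omega
    have h1 : n ≠ 1 := by omega
    simp [h0, h1]
  obtain ⟨-, -, hshift, -, -⟩ := stub_qFormRecursion ℓ k hk Ω G (hΩ0 k) (hΩ0 (k + 1)) (hG0 k)
    (hG0 (k + 1)) (hinv k) (hinv (k + 1)) hrung
    (fun n => (∑ i ∈ Finset.range (n + 1), G (k + 1) i * Ω k (n - i)) - if n = 0 then 1 else 0)
    (fun m : ℕ => if m = 0 then (0 : ℝ) else if m = 1 then -2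
        else (1 - (m : ℝ)) * G k m + 2 * ((m : ℝ) - 2) * G k (m - 1))
    (fun n => rfl) (by simp) (by simp) hαn
  exact hshift

/-- **One rung of the majorant induction** (`n ≥ 2`): the registered rung step
`stub_rungStepMajorant` (taken as the hypothesis `hstep`), fed with the convolution constants
(hypothesis `hCV`, the statement of `stub_convolutionBounds`) and the exact `q`-form identities of `stub_qFormRecursion` for the arrays
`q n := Σ_{i≤n} G (k+1) i · Ω k (n-i) - [n = 0]` and `α n := (1-n) G k n + 2(n-2) G k (n-1)`
(`α 0 = 0`, `α 1 = -2`), turns the profile bound with radius `B/θ` at rung `k` into the profile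
bound with radius `(B + Δ_λ)/(θ (1 - 2/(2λ-1)²))` at rung `k + 1`. -/
theorem coeffMajorantAssembly_rung
    (hCV : (∀ (lam : ℝ) (n : ℕ), 2 ≤ lam → 2 ≤ n →
      ∑ i ∈ Finset.Ico 2 n, (1 / ((i : ℝ) ^ 2)) * (1 / ((((n - i : ℕ) : ℝ)) * (2 * lam - 1 + ((n -
      i : ℕ) : ℝ)))) ≤ 16 * (((n : ℝ) - 1) / n) * (1 / ((n : ℝ) * (2 * lam - 1 + n)))) ∧
      (∀ (lam : ℝ) (m : ℕ), 2 ≤ lam → 2 ≤ m →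
      ∑ i ∈ Finset.Ico 1 m, (1 / ((i : ℝ) * (2 * lam - 1 + i))) * (1 / ((((m - i : ℕ) : ℝ)) * (2 *
      lam - 1 + ((m - i : ℕ) : ℝ)))) ≤ (16 / 3) * (1 / ((m : ℝ) * (2 * lam - 1 + m))) * (1 +
      Real.log (2 * lam)) / lam) ∧
      (∀ (lam : ℝ) (n : ℕ), 2 ≤ lam → 1 ≤ n →
      (n : ℝ) * ∑ i ∈ Finset.Ico 1 n, (1 / (i : ℝ)) * (1 / ((((n - i : ℕ) : ℝ)) * (2 * lam - 1 +
      ((n - i : ℕ) : ℝ)))) ≤ 4) ∧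
      (∀ (lam : ℝ) (n : ℕ), 2 ≤ lam → 2 ≤ n →
      ∑ i ∈ Finset.Ico 2 n, (1 / ((i : ℝ) ^ 2)) * (1 / (2 * lam - 1 + ((n - i : ℕ) : ℝ))) ≤ 3 / (2
      * lam - 1 + n)) ∧
      (∀ (lam n : ℕ), 2 ≤ lam → 2 * lam ≤ n →
      3 * (lam : ℝ) / (2 * (lam : ℝ) - 1 + n) ≤ 2 * ((n : ℝ) - 1) / (2 * (lam : ℝ) - 1) ^ 2 + 1 -
      (lam : ℝ) * ((n : ℝ) + 1 - 2 * lam) / (((lam : ℝ) - 1) * (2 * (lam : ℝ) - 1 + n))))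
    (hstep : ((∀ (lam : ℝ) (n : ℕ), 2 ≤ lam → 2 ≤ n →
      ∑ i ∈ Finset.Ico 2 n, (1 / ((i : ℝ) ^ 2)) * (1 / ((((n - i : ℕ) : ℝ)) * (2 * lam - 1 + ((n -
      i : ℕ) : ℝ)))) ≤ 16 * (((n : ℝ) - 1) / n) * (1 / ((n : ℝ) * (2 * lam - 1 + n)))) ∧
      (∀ (lam : ℝ) (m : ℕ), 2 ≤ lam → 2 ≤ m →
      ∑ i ∈ Finset.Ico 1 m, (1 / ((i : ℝ) * (2 * lam - 1 + i))) * (1 / ((((m - i : ℕ) : ℝ)) * (2 *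
      lam - 1 + ((m - i : ℕ) : ℝ)))) ≤ (16 / 3) * (1 / ((m : ℝ) * (2 * lam - 1 + m))) * (1 +
      Real.log (2 * lam)) / lam) ∧
      (∀ (lam : ℝ) (n : ℕ), 2 ≤ lam → 1 ≤ n →
      (n : ℝ) * ∑ i ∈ Finset.Ico 1 n, (1 / (i : ℝ)) * (1 / ((((n - i : ℕ) : ℝ)) * (2 * lam - 1 +
      ((n - i : ℕ) : ℝ)))) ≤ 4) ∧
      (∀ (lam : ℝ) (n : ℕ), 2 ≤ lam → 2 ≤ n →
      ∑ i ∈ Finset.Ico 2 n, (1 / ((i : ℝ) ^ 2)) * (1 / (2 * lam - 1 + ((n - i : ℕ) : ℝ))) ≤ 3 / (2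
      * lam - 1 + n)) ∧
      (∀ (lam n : ℕ), 2 ≤ lam → 2 * lam ≤ n →
      3 * (lam : ℝ) / (2 * (lam : ℝ) - 1 + n) ≤ 2 * ((n : ℝ) - 1) / (2 * (lam : ℝ) - 1) ^ 2 + 1 -
      (lam : ℝ) * ((n : ℝ) + 1 - 2 * lam) / (((lam : ℝ) - 1) * (2 * (lam : ℝ) - 1 + n)))) →
      ∀ (ℓ k : ℕ), k + 2 ≤ ℓ → ∀ (θ B : ℝ) (Gk Gk1 q α : ℕ → ℝ), 0 < θ → θ ≤ 1 / 1024 → 16 ≤ B →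
      |Gk 1| ≤ B → Gk 0 = 1 → α 0 = 0 → α 1 = -2 → (∀ n, 2 ≤ n →
      α n = (1 - (n : ℝ)) * Gk n + 2 * ((n : ℝ) - 2) * Gk (n - 1)) → q 0 = 0 →
      q 1 = -((2 * ((ℓ : ℝ) - k) - 1) / (((ℓ : ℝ) - k) * (((ℓ : ℝ) - k) - 1))) → (∀ n, 2 ≤ n →
      Gk1 n = Gk n + q n + Gk 1 * q (n - 1) + ∑ i ∈ Finset.Ico 2 n, Gk i * q (n - i)) →
      (∀ n, 2 ≤ n →
      (((ℓ : ℝ) - k) - 1) * (2 * ((ℓ : ℝ) - k) - 1 + n) * q n = (2 * ((ℓ : ℝ) - k) - 1) * α n -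
      (((ℓ : ℝ) - k) - 1) * Gk 1 * ((n : ℝ) - 1) * q (n - 1) - (((ℓ : ℝ) - k) - 1) * ∑ i ∈
      Finset.Ico 2 n, Gk i * ((n : ℝ) - i) * q (n - i) + 2 * (((ℓ : ℝ) - k) - 1) * (((n : ℝ) - 1) *
      q (n - 1) + Gk 1 * ((n : ℝ) - 2) * q (n - 2) + ∑ i ∈ Finset.Ico 2 (n - 1), Gk i * ((n : ℝ) -
      1 - i) * q (n - 1 - i)) - ((ℓ : ℝ) - k) * (((ℓ : ℝ) - k) - 1) * ∑ i ∈ Finset.Ico 1 n, q i * q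
      (n - i) + (3 * ((ℓ : ℝ) - k) - 1) * ∑ i ∈ Finset.Ico 1 n, α i * q (n - i) + ((ℓ : ℝ) - k) * ∑
      i ∈ Finset.Ico 1 (n - 1), α i * ∑ j ∈ Finset.Ico 1 (n - i), q j * q (n - i - j)) →
      (∀ n, 2 ≤ n → |Gk n| ≤ 2 * (B / θ) ^ (n - 1) / (n : ℝ) ^ 2) → ∀ n, 2 ≤ n →
      |Gk1 n| ≤ 2 * ((B + (2 * ((ℓ : ℝ) - k) - 1) / (((ℓ : ℝ) - k) * (((ℓ : ℝ) - k) - 1))) / (θ *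
      (1 - 2 / (2 * ((ℓ : ℝ) - k) - 1) ^ 2))) ^ (n - 1) / (n : ℝ) ^ 2)
    (ℓ k : ℕ) (hk : k + 2 ≤ ℓ) (Ω G : ℕ → ℕ → ℝ)
    (hΩ0 : ∀ k, Ω k 0 = 1) (hG0 : ∀ k, G k 0 = 1)
    (hinv : ∀ k n, ∑ i ∈ Finset.range (n + 1), G k i * Ω k (n - i) = if n = 0 then 1 else 0)
    (hrung : ∀ n, ((ℓ : ℝ) - k - 1) ^ 2 * ∑ i ∈ Finset.range (n + 1), Ω (k + 1) i * Ω (k + 1) (n - i)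
          + ((ℓ : ℝ) - k - 1) * (((n : ℝ) + 1) * Ω (k + 1) n - 2 * (n : ℝ) * Ω (k + 1) (n - 1))
          = ((ℓ : ℝ) - k) ^ 2 * ∑ i ∈ Finset.range (n + 1), Ω k i * Ω k (n - i)
          - ((ℓ : ℝ) - k) * (((n : ℝ) + 1) * Ω k n - 2 * (n : ℝ) * Ω k (n - 1)))
    (θ B : ℝ) (hθ : 0 < θ) (hθ' : θ ≤ 1 / 1024) (hB : 16 ≤ B) (hG1 : |G k 1| ≤ B)
    (hprof : ∀ n, 2 ≤ n → |G k n| ≤ 2 * (B / θ) ^ (n - 1) / (n : ℝ) ^ 2) :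
    ∀ n, 2 ≤ n → |G (k + 1) n| ≤ 2 * ((B + (2 * ((ℓ : ℝ) - k) - 1) / (((ℓ : ℝ) - k) * (((ℓ : ℝ) - k) - 1)))
      / (θ * (1 - 2 / (2 * ((ℓ : ℝ) - k) - 1) ^ 2))) ^ (n - 1) / (n : ℝ) ^ 2 := by
  have hα0 : (fun m : ℕ => if m = 0 then (0 : ℝ) else if m = 1 then -2
      else (1 - (m : ℝ)) * G k m + 2 * ((m : ℝ) - 2) * G k (m - 1)) 0 = 0 := by simp
  have hα1 : (fun m : ℕ => if m = 0 then (0 : ℝ) else if m = 1 then -2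
      else (1 - (m : ℝ)) * G k m + 2 * ((m : ℝ) - 2) * G k (m - 1)) 1 = -2 := by simp
  have hαn : ∀ n : ℕ, 2 ≤ n →
      (fun m : ℕ => if m = 0 then (0 : ℝ) else if m = 1 then -2
        else (1 - (m : ℝ)) * G k m + 2 * ((m : ℝ) - 2) * G k (m - 1)) n
        = (1 - (n : ℝ)) * G k n + 2 * ((n : ℝ) - 2) * G k (n - 1) := by
    intro n hn
    have h0 : n ≠ 0 := by omega
    have h1 : n ≠ 1 := by omega
    simp [h0, h1]
  obtain ⟨hq0, hq1, -, hout, hrec⟩ := stub_qFormRecursion ℓ k hk Ω G (hΩ0 k) (hΩ0 (k + 1)) (hG0 k)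
    (hG0 (k + 1)) (hinv k) (hinv (k + 1)) hrung
    (fun n => (∑ i ∈ Finset.range (n + 1), G (k + 1) i * Ω k (n - i)) - if n = 0 then 1 else 0)
    (fun m : ℕ => if m = 0 then (0 : ℝ) else if m = 1 then -2
        else (1 - (m : ℝ)) * G k m + 2 * ((m : ℝ) - 2) * G k (m - 1))
    (fun n => rfl) hα0 hα1 hαn
  exact hstep hCV ℓ k hk θ B (G k) (G (k + 1)) _ _ hθ hθ' hB hG1 (hG0 k)
    hα0 hα1 hαn hq0 hq1 hout hrec hprof

/-- **Theorem A assembly.**  The registered rung step `stub_rungStepMajorant` (hypothesis `hstep`,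
verbatim statement), together with the convolution constants `stub_convolutionBounds` (hypothesis
`hCV`, verbatim statement), implies the registered stub `stub_coeffMajorant` (verbatim statement),
with `K = 80000`: induction along the ladder with `B_k = 16 + Σ_{j<k} Δ_{ℓ-j}`,
`θ_k = 2⁻¹⁰ ∏_{j<k} (1 - 2/(2(ℓ-j)-1)²)` (`coeffMajorantAssembly_induction`, base
`stub_rungZeroMajorant`, step `coeffMajorantAssembly_shift`/`coeffMajorantAssembly_rung`), then the
export `2 B_k/θ_k ≤ 4608 (17 + 2 log ℓ) ≤ 80000 (1 + log (ℓ+1))` (`stub_chainBookkeeping`) and the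
inversion majorant `coeffMajorant_inversion` for the `Ω`-clause. -/
theorem coeffMajorant_of_rungStep :
    ((∀ (lam : ℝ) (n : ℕ), 2 ≤ lam → 2 ≤ n →
      ∑ i ∈ Finset.Ico 2 n, (1 / ((i : ℝ) ^ 2)) * (1 / ((((n - i : ℕ) : ℝ)) * (2 * lam - 1 + ((n -
      i : ℕ) : ℝ)))) ≤ 16 * (((n : ℝ) - 1) / n) * (1 / ((n : ℝ) * (2 * lam - 1 + n)))) ∧
      (∀ (lam : ℝ) (m : ℕ), 2 ≤ lam → 2 ≤ m →
      ∑ i ∈ Finset.Ico 1 m, (1 / ((i : ℝ) * (2 * lam - 1 + i))) * (1 / ((((m - i : ℕ) : ℝ)) * (2 *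
      lam - 1 + ((m - i : ℕ) : ℝ)))) ≤ (16 / 3) * (1 / ((m : ℝ) * (2 * lam - 1 + m))) * (1 +
      Real.log (2 * lam)) / lam) ∧
      (∀ (lam : ℝ) (n : ℕ), 2 ≤ lam → 1 ≤ n →
      (n : ℝ) * ∑ i ∈ Finset.Ico 1 n, (1 / (i : ℝ)) * (1 / ((((n - i : ℕ) : ℝ)) * (2 * lam - 1 +
      ((n - i : ℕ) : ℝ)))) ≤ 4) ∧
      (∀ (lam : ℝ) (n : ℕ), 2 ≤ lam → 2 ≤ n →
      ∑ i ∈ Finset.Ico 2 n, (1 / ((i : ℝ) ^ 2)) * (1 / (2 * lam - 1 + ((n - i : ℕ) : ℝ))) ≤ 3 / (2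
      * lam - 1 + n)) ∧
      (∀ (lam n : ℕ), 2 ≤ lam → 2 * lam ≤ n →
      3 * (lam : ℝ) / (2 * (lam : ℝ) - 1 + n) ≤ 2 * ((n : ℝ) - 1) / (2 * (lam : ℝ) - 1) ^ 2 + 1 -
      (lam : ℝ) * ((n : ℝ) + 1 - 2 * lam) / (((lam : ℝ) - 1) * (2 * (lam : ℝ) - 1 + n)))) →
    (((∀ (lam : ℝ) (n : ℕ), 2 ≤ lam → 2 ≤ n →
      ∑ i ∈ Finset.Ico 2 n, (1 / ((i : ℝ) ^ 2)) * (1 / ((((n - i : ℕ) : ℝ)) * (2 * lam - 1 + ((n -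
      i : ℕ) : ℝ)))) ≤ 16 * (((n : ℝ) - 1) / n) * (1 / ((n : ℝ) * (2 * lam - 1 + n)))) ∧
      (∀ (lam : ℝ) (m : ℕ), 2 ≤ lam → 2 ≤ m →
      ∑ i ∈ Finset.Ico 1 m, (1 / ((i : ℝ) * (2 * lam - 1 + i))) * (1 / ((((m - i : ℕ) : ℝ)) * (2 *
      lam - 1 + ((m - i : ℕ) : ℝ)))) ≤ (16 / 3) * (1 / ((m : ℝ) * (2 * lam - 1 + m))) * (1 +
      Real.log (2 * lam)) / lam) ∧
      (∀ (lam : ℝ) (n : ℕ), 2 ≤ lam → 1 ≤ n →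
      (n : ℝ) * ∑ i ∈ Finset.Ico 1 n, (1 / (i : ℝ)) * (1 / ((((n - i : ℕ) : ℝ)) * (2 * lam - 1 +
      ((n - i : ℕ) : ℝ)))) ≤ 4) ∧
      (∀ (lam : ℝ) (n : ℕ), 2 ≤ lam → 2 ≤ n →
      ∑ i ∈ Finset.Ico 2 n, (1 / ((i : ℝ) ^ 2)) * (1 / (2 * lam - 1 + ((n - i : ℕ) : ℝ))) ≤ 3 / (2
      * lam - 1 + n)) ∧
      (∀ (lam n : ℕ), 2 ≤ lam → 2 * lam ≤ n →
      3 * (lam : ℝ) / (2 * (lam : ℝ) - 1 + n) ≤ 2 * ((n : ℝ) - 1) / (2 * (lam : ℝ) - 1) ^ 2 + 1 -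
      (lam : ℝ) * ((n : ℝ) + 1 - 2 * lam) / (((lam : ℝ) - 1) * (2 * (lam : ℝ) - 1 + n)))) →
      ∀ (ℓ k : ℕ), k + 2 ≤ ℓ → ∀ (θ B : ℝ) (Gk Gk1 q α : ℕ → ℝ), 0 < θ → θ ≤ 1 / 1024 → 16 ≤ B →
      |Gk 1| ≤ B → Gk 0 = 1 → α 0 = 0 → α 1 = -2 → (∀ n, 2 ≤ n →
      α n = (1 - (n : ℝ)) * Gk n + 2 * ((n : ℝ) - 2) * Gk (n - 1)) → q 0 = 0 →
      q 1 = -((2 * ((ℓ : ℝ) - k) - 1) / (((ℓ : ℝ) - k) * (((ℓ : ℝ) - k) - 1))) → (∀ n, 2 ≤ n →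
      Gk1 n = Gk n + q n + Gk 1 * q (n - 1) + ∑ i ∈ Finset.Ico 2 n, Gk i * q (n - i)) →
      (∀ n, 2 ≤ n →
      (((ℓ : ℝ) - k) - 1) * (2 * ((ℓ : ℝ) - k) - 1 + n) * q n = (2 * ((ℓ : ℝ) - k) - 1) * α n -
      (((ℓ : ℝ) - k) - 1) * Gk 1 * ((n : ℝ) - 1) * q (n - 1) - (((ℓ : ℝ) - k) - 1) * ∑ i ∈
      Finset.Ico 2 n, Gk i * ((n : ℝ) - i) * q (n - i) + 2 * (((ℓ : ℝ) - k) - 1) * (((n : ℝ) - 1) *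
      q (n - 1) + Gk 1 * ((n : ℝ) - 2) * q (n - 2) + ∑ i ∈ Finset.Ico 2 (n - 1), Gk i * ((n : ℝ) -
      1 - i) * q (n - 1 - i)) - ((ℓ : ℝ) - k) * (((ℓ : ℝ) - k) - 1) * ∑ i ∈ Finset.Ico 1 n, q i * q
      (n - i) + (3 * ((ℓ : ℝ) - k) - 1) * ∑ i ∈ Finset.Ico 1 n, α i * q (n - i) + ((ℓ : ℝ) - k) * ∑
      i ∈ Finset.Ico 1 (n - 1), α i * ∑ j ∈ Finset.Ico 1 (n - i), q j * q (n - i - j)) →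
      (∀ n, 2 ≤ n → |Gk n| ≤ 2 * (B / θ) ^ (n - 1) / (n : ℝ) ^ 2) → ∀ n, 2 ≤ n →
      |Gk1 n| ≤ 2 * ((B + (2 * ((ℓ : ℝ) - k) - 1) / (((ℓ : ℝ) - k) * (((ℓ : ℝ) - k) - 1))) / (θ *
      (1 - 2 / (2 * ((ℓ : ℝ) - k) - 1) ^ 2))) ^ (n - 1) / (n : ℝ) ^ 2) →
    ∃ K : ℝ, 1 ≤ K ∧ ∀ (s ℓ : ℕ), s ≤ 2 → s ≤ ℓ → 1 ≤ ℓ → ∀ (Ω G : ℕ → ℕ → ℝ), (∀ k, Ω k 0 = 1) →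
      (∀ k, G k 0 = 1) →
      (∀ k n, ∑ i ∈ Finset.range (n + 1), G k i * Ω k (n - i) = if n = 0 then 1 else 0) →
      (∀ n, (ℓ : ℝ) ^ 2 * ∑ i ∈ Finset.range (n + 1), Ω 0 i * Ω 0 (n - i) + (ℓ : ℝ) * (((n : ℝ) +
      1) * Ω 0 n - 2 * (n : ℝ) * Ω 0 (n - 1)) = (if n = 0 then (ℓ : ℝ) * ((ℓ : ℝ) + 1) else if n =
      1 then 2 * (1 - (s : ℝ) ^ 2) - 2 * ((ℓ : ℝ) * ((ℓ : ℝ) + 1)) else if n = 2 then -(4 * (1 - (s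
      : ℝ) ^ 2)) else 0)) →
      (∀ k, k + 2 ≤ ℓ →
      ∀ n, ((ℓ : ℝ) - k - 1) ^ 2 * ∑ i ∈ Finset.range (n + 1), Ω (k + 1) i * Ω (k + 1) (n - i) +
      ((ℓ : ℝ) - k - 1) * (((n : ℝ) + 1) * Ω (k + 1) n - 2 * (n : ℝ) * Ω (k + 1) (n - 1)) = ((ℓ :
      ℝ) - k) ^ 2 * ∑ i ∈ Finset.range (n + 1), Ω k i * Ω k (n - i) - ((ℓ : ℝ) - k) * (((n : ℝ) +
      1) * Ω k n - 2 * (n : ℝ) * Ω k (n - 1))) →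
      ∀ k, k + 1 ≤ ℓ → |G k 1| ≤ K * (1 + Real.log ((ℓ : ℝ) + 1)) ∧ (∀ n, 2 ≤ n →
      |G k n| ≤ (K * (1 + Real.log ((ℓ : ℝ) + 1))) ^ (n - 1)) ∧
      (∀ n, |Ω k n| ≤ (K * (1 + Real.log ((ℓ : ℝ) + 1))) ^ n) := by
  intro hCV hstep
  refine ⟨80000, by norm_num, ?_⟩
  intro s ℓ hs hsℓ hℓ Ω G hΩ0 hG0 hinv hrec0 hrung k hk
  have hℓR : (1 : ℝ) ≤ ℓ := by exact_mod_cast hℓ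
  -- the schedules
  obtain ⟨hP1, hP2, -⟩ := stub_chainBookkeeping
  obtain ⟨h01eq, h01lo, h01hi, h0n⟩ :=
    stub_rungZeroMajorant s ℓ hs hsℓ hℓ Ω G (hΩ0 0) (hG0 0) (hinv 0) hrec0
  have hind := coeffMajorantAssembly_induction ℓ G
    (fun j => (2 * ((ℓ : ℝ) - j) - 1) / (((ℓ : ℝ) - j) * (((ℓ : ℝ) - j) - 1)))
    (fun j => 1 - 2 / (2 * ((ℓ : ℝ) - j) - 1) ^ 2)
    (fun k => 16 + ∑ j ∈ Finset.range k, (2 * ((ℓ : ℝ) - j) - 1) / (((ℓ : ℝ) - j) * (((ℓ : ℝ) - j) - 1)))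
    (fun k => (1 / 1024) * ∏ j ∈ Finset.range k, (1 - 2 / (2 * ((ℓ : ℝ) - j) - 1) ^ 2))
    (fun k => rfl) (fun k => rfl)
    (by
      intro k hk2
      have hk' : (k : ℝ) + 2 ≤ ℓ := by exact_mod_cast hk2
      apply div_nonneg <;> [skip; apply mul_nonneg] <;> linarith)
    (by
      intro k hk2
      have hk' : (k : ℝ) + 2 ≤ ℓ := by exact_mod_cast hk2
      have hx : (3 : ℝ) ≤ 2 * ((ℓ : ℝ) - k) - 1 := by linarith
      have hx2 : (9 : ℝ) ≤ (2 * ((ℓ : ℝ) - k) - 1) ^ 2 := by nlinarith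
      have hlt : 2 / (2 * ((ℓ : ℝ) - k) - 1) ^ 2 < 1 := by
        rw [div_lt_one (by linarith)]
        linarith
      have hnn : 0 ≤ 2 / (2 * ((ℓ : ℝ) - k) - 1) ^ 2 := by positivity
      constructor <;> linarith)
    (by
      have h : |G 0 1| = G 0 1 := abs_of_nonneg h01lo
      linarith)
    h0n
    (fun k hk2 => coeffMajorantAssembly_shift ℓ k hk2 Ω G hΩ0 hG0 hinv (hrung k hk2))
    (fun k hk2 hθ hθ' hB hG1 hprof =>
      coeffMajorantAssembly_rung hCV hstep ℓ k hk2 Ω G hΩ0 hG0 hinv (hrung k hk2) _ _ hθ hθ' hB hG1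
        hprof)
    k hk
  obtain ⟨h16, h1, hθpos, hθle, hn⟩ := hind
  -- abbreviations for the radius data at rung `k`
  set Bk : ℝ := 16 + ∑ j ∈ Finset.range k, (2 * ((ℓ : ℝ) - j) - 1) / (((ℓ : ℝ) - j) * (((ℓ : ℝ) - j) - 1))
    with hBk_def
  set θk : ℝ := (1 / 1024) * ∏ j ∈ Finset.range k, (1 - 2 / (2 * ((ℓ : ℝ) - j) - 1) ^ 2) with hθk_def
  have hBk0 : 0 ≤ Bk := by linarith
  -- (P1): the angle never drops below `(4/9)·2⁻¹⁰`
  have hθlow : (1 / 1024) * (4 / 9) ≤ θk := by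
    have := hP1 ℓ k hk
    rw [hθk_def]
    exact mul_le_mul_of_nonneg_left this (by norm_num)
  -- (P2): the radius is logarithmic
  have hBkle : Bk ≤ 17 + 2 * Real.log ℓ := by
    have := hP2 ℓ k hk
    rw [hBk_def]
    linarith
  -- the combined radius `A = Bk/θk`
  set A : ℝ := Bk / θk with hA_def
  have hApos : 0 < A := div_pos (by linarith) hθpos
  have hBleA : Bk ≤ A := by
    rw [hA_def, le_div_iff₀ hθpos]
    calc Bk * θk ≤ Bk * 1 := mul_le_mul_of_nonneg_left (by linarith) hBk0
      _ = Bk := mul_one _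
  have hA1 : 1 ≤ A := by linarith
  have hAle : A ≤ (17 + 2 * Real.log ℓ) / ((1 / 1024) * (4 / 9)) := by
    rw [hA_def]
    calc Bk / θk ≤ Bk / ((1 / 1024) * (4 / 9)) :=
          div_le_div_of_nonneg_left hBk0 (by norm_num) hθlow
      _ ≤ (17 + 2 * Real.log ℓ) / ((1 / 1024) * (4 / 9)) :=
          div_le_div_of_nonneg_right hBkle (by norm_num)
  -- logarithms
  have hlog0 : 0 ≤ Real.log ℓ := Real.log_nonneg hℓR
  have hlog1 : Real.log ℓ ≤ Real.log ((ℓ : ℝ) + 1) :=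
    Real.log_le_log (by linarith) (by linarith)
  set Lg : ℝ := 1 + Real.log ((ℓ : ℝ) + 1) with hLg_def
  have hLg1 : 1 ≤ Lg := by
    have : 0 ≤ Real.log ((ℓ : ℝ) + 1) := Real.log_nonneg (by linarith)
    linarith
  have h2A : 2 * A ≤ 80000 * Lg := by
    have h17 : 17 + 2 * Real.log ℓ ≤ 17 * Lg := by rw [hLg_def]; nlinarith
    have : (17 + 2 * Real.log ℓ) / ((1 / 1024) * (4 / 9)) = 2304 * (17 + 2 * Real.log ℓ) := by
      field_simp
      ring
    rw [this] at hAle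
    nlinarith
  have hAK : A ≤ 80000 * Lg := by linarith
  -- the weak profile `|G k n| ≤ A^(n-1)` for `n ≥ 2`
  have hGw : ∀ n, 2 ≤ n → |G k n| ≤ A ^ (n - 1) := by
    intro n hn2
    have hnR : (2 : ℝ) ≤ n := by exact_mod_cast hn2
    have hn2R : (4 : ℝ) ≤ (n : ℝ) ^ 2 := by nlinarith
    have hpow : 0 ≤ A ^ (n - 1) := pow_nonneg hApos.le _
    have h := hn n hn2
    calc |G k n| ≤ 2 * (Bk / θk) ^ (n - 1) / (n : ℝ) ^ 2 := h
      _ = A ^ (n - 1) * (2 / (n : ℝ) ^ 2) := by rw [hA_def]; ring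
      _ ≤ A ^ (n - 1) * 1 := by
          apply mul_le_mul_of_nonneg_left _ hpow
          rw [div_le_one (by positivity)]
          linarith
      _ = A ^ (n - 1) := mul_one _
  have hG1A : |G k 1| ≤ A := by linarith [abs_nonneg (G k 1)]
  refine ⟨?_, ?_, ?_⟩
  · -- mode 1
    linarith [abs_nonneg (G k 1)]
  · -- modes n ≥ 2
    intro n hn2
    calc |G k n| ≤ A ^ (n - 1) := hGw n hn2
      _ ≤ (80000 * Lg) ^ (n - 1) := pow_le_pow_left₀ hApos.le hAK _
  · -- the inverse series
    intro n
    have hΩ := coeffMajorant_inversion A (G k) (Ω k) hA1 (hG0 k) hG1A hGw (hinv k) n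
    calc |Ω k n| ≤ (2 * A) ^ n := hΩ
      _ ≤ (80000 * Lg) ^ n := pow_le_pow_left₀ (by positivity) h2A _

end Summit.FinalStateConjecture.FinalStateConjecture.Theorems.CrumPeelingRecessiveTower
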